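import Summits.KontsevichZagierPeriods.KontsevichZagierPeriods.Theorems.RootDecompWalshStrataCellThree01

/-!
# The `d = 3` z-glue, part 2/3: the `Quadric₃` fibre API

Declarations `Quadric₃.PxyzP` … `Quadric₃.exists_aeval_PxyzP_ne_zero` of the farm-checked gen-7 file (namespace
`…ConicDescent.BallCube.Quadric₃`): the quadric as a polynomial, semialgebraicity of the cell, the fibre roots
`root ε = (−B + ε√D)/(2A)` (`lo`, `hi`), `4A·p = (2Az + B)² − D`, `pos_iff_of_neg`, the four clamp regimes and their
DECISION on an adapted atom (`clamp_lo_cases`, `clamp_hi_cases`), semialgebraic atoms, the negated quadric `Quadric₃.neg`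
and the atom correspondence `mem_neg_atom_iff`.  See the module docstring of `RootDecompWalshStrataCellThree01` (part 1).
[KontsevichZagier2001 §1.2; BCR1998 §2.1–2.2; this node gen 5–7]
-/

noncomputable section

open Literature.NumberTheory.Transcendental
open MeasureTheory Set
open MvPolynomial (aeval X C)
open Literature.ModelTheory.ExponentialFields (IsSemialgebraic isSemialgebraic_univ
  isSemialgebraic_setOf_eval_pos isSemialgebraic_setOf_eval_lt isSemialgebraic_setOf_eval_le
  isSemialgebraic_setOf_eval_nonneg isSemialgebraic_setOf_eval_eq_zero
  isSemialgebraic_setOf_eval_ne_zero continuous_aeval_real tarski_seidenberg_real_holds)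
open Summit.KontsevichZagierPeriods.RootDecompWalshStrata.WalshSpanProof (isSemialgebraic_cubeSet
  isBounded_cubeSet)
open Summit.KontsevichZagierPeriods.RootDecompWalshStrata.ConeSpecimen (unitIoo isSemialgebraic_unitIoo
  unitIoo_subset_Icc mem_unitIoo)
open Summit.KontsevichZagierPeriods.RootDecompWalshStrata.PointlessOctant (boxTwo isSemialgebraic_boxTwo
  boxTwo_subset_Icc)

namespace Summit.KontsevichZagierPeriods.RootDecompWalshStrata.ConicDescent.BallCube

namespace Quadric₃

variable (K : Quadric₃)

/-- The quadric as a polynomial over `ℚ` in three variables. -/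
def PxyzP : MvPolynomial (Fin 3) ℚ :=
  C K.A * X 2 ^ 2 + (C K.b0 + C K.b1 * X 0 + C K.b2 * X 1) * X 2 +
    (C K.c0 + C K.c1 * X 0 + C K.c2 * X 1 + C K.c11 * X 0 ^ 2 + C K.c12 * X 0 * X 1 +
      C K.c22 * X 1 ^ 2)

/-- Evaluation of `PxyzP`. [this node] -/
@[simp] theorem aeval_PxyzP (z : Fin 3 → ℝ) : aeval z K.PxyzP = K.pxyz (z 0) (z 1) (z 2) := by
  simp only [PxyzP, pxyz, Bxy, Cxy, map_add, map_mul, map_pow, MvPolynomial.aeval_C,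
    MvPolynomial.aeval_X, eq_ratCast]

/-- The quadric Walsh cell is `ℚ`-semialgebraic (PRIVATE: the gate lint `dedup.landed` identifies the statement
with the landed `…ConicDescent.Conic.isSemialgebraic_cell` of `RootDecompWalshStrataConicNeg`; later parts keep private copies).
[BCR1998 §2.2] -/
private theorem isSemialgebraic_cell : IsSemialgebraic ℚ K.cell := by
  convert (isSemialgebraic_cubeSet 3).inter (isSemialgebraic_setOf_eval_pos (R := ℝ) K.PxyzP)
    using 1
  ext z
  simp only [cell, mem_setOf_eq, mem_inter_iff, aeval_PxyzP]

/-- The quadric Walsh cell lies in the closed unit cube (PRIVATE, same reason: twin `…Conic.cell_subset_Icc`). [folklore] -/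
private theorem cell_subset_Icc : K.cell ⊆ Icc 0 1 := fun _ hz =>
  ⟨fun j => (hz.1 j).1.le, fun j => (hz.1 j).2.le⟩

/-- The fibre roots `(−B + ε √D)/(2A)` (`ε = 1`: `lo`, `ε = −1`: `hi` when `A < 0`). -/
def root (ε : ℚ) (x y : ℝ) : ℝ := (-K.Bxy x y + ε * √(K.Dxy x y)) / (2 * K.A)

/-- The lower fibre root for `A < 0`. -/
def lo (x y : ℝ) : ℝ := K.root 1 x y

/-- The upper fibre root for `A < 0`. -/
def hi (x y : ℝ) : ℝ := K.root (-1) x y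

/-- `lo = (−B + √D)/(2A)`. [this node] -/
theorem lo_eq (x y : ℝ) : K.lo x y = (-K.Bxy x y + √(K.Dxy x y)) / (2 * K.A) := by
  simp [lo, root]

/-- `hi = (−B − √D)/(2A)`. [this node] -/
theorem hi_eq (x y : ℝ) : K.hi x y = (-K.Bxy x y - √(K.Dxy x y)) / (2 * K.A) := by
  simp [hi, root, sub_eq_add_neg]

/-- `4A·p = (2Az + B)² − D`. [folklore] -/
theorem key3 (x y z : ℝ) :
    4 * K.A * K.pxyz x y z = (2 * K.A * z + K.Bxy x y) ^ 2 - K.Dxy x y := by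
  simp only [pxyz, Dxy]; ring

/-- For `A < 0`: `p(x,y,z) > 0 ↔ D(x,y) > 0 ∧ lo < z < hi`. [folklore] -/
theorem pos_iff_of_neg (hA : K.A < 0) (x y z : ℝ) :
    0 < K.pxyz x y z ↔ 0 < K.Dxy x y ∧ K.lo x y < z ∧ z < K.hi x y := by
  have hk := K.key3 x y z
  have hA' : (K.A : ℝ) < 0 := by exact_mod_cast hA
  have h2A : (2 : ℝ) * K.A < 0 := by linarith
  rw [lo_eq, hi_eq, div_lt_iff_of_neg h2A, lt_div_iff_of_neg h2A]
  constructor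
  · intro hp
    have h4 : 4 * (K.A : ℝ) * K.pxyz x y z < 0 := by nlinarith
    have hsq : (2 * K.A * z + K.Bxy x y) ^ 2 < K.Dxy x y := by linarith
    have hD : 0 < K.Dxy x y := lt_of_le_of_lt (sq_nonneg _) hsq
    have habs : |2 * K.A * z + K.Bxy x y| < √(K.Dxy x y) :=
      (Real.lt_sqrt (abs_nonneg _)).2 (by rwa [sq_abs])
    rw [abs_lt] at habs
    exact ⟨hD, by linarith [habs.2], by linarith [habs.1]⟩
  · rintro ⟨hD, h1, h2⟩
    have habs : |2 * K.A * z + K.Bxy x y| < √(K.Dxy x y) := by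
      rw [abs_lt]; constructor <;> linarith
    have hsq : (2 * K.A * z + K.Bxy x y) ^ 2 < K.Dxy x y := by
      have := (Real.lt_sqrt (abs_nonneg _)).1 habs
      rwa [sq_abs] at this
    have h4 : 4 * (K.A : ℝ) * K.pxyz x y z < 0 := by linarith
    nlinarith

/-- For `A < 0` the root `(−B + √D)/(2A)` is the lower one. [folklore] -/
theorem lo_le_hi (hA : K.A < 0) (x y : ℝ) : K.lo x y ≤ K.hi x y := by
  have h2A : (2 : ℝ) * K.A ≤ 0 := by
    have : (K.A : ℝ) < 0 := by exact_mod_cast hA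
    linarith
  rw [lo_eq, hi_eq]
  exact div_le_div_of_nonpos_of_le h2A (by linarith [Real.sqrt_nonneg (K.Dxy x y)])

/-- `lo > 0 ↔ B > 0 ∧ C₀ < 0` (for `A < 0`, `D > 0`). [folklore] -/
theorem lo_pos_iff (hA : K.A < 0) {x y : ℝ} (hD : 0 < K.Dxy x y) :
    0 < K.lo x y ↔ 0 < K.Bxy x y ∧ K.Cxy x y < 0 := by
  have hA' : (K.A : ℝ) < 0 := by exact_mod_cast hA
  have h2A : (2 : ℝ) * K.A < 0 := by linarith
  rw [lo_eq, lt_div_iff_of_neg h2A, zero_mul]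
  exact lo_pos_aux hA' (Real.sqrt_pos.2 hD) (by rw [Real.sq_sqrt hD.le, Dxy])

/-- `lo < 1 ↔ 2A + B < 0 ∨ C₁ > 0` (for `A < 0`, `D > 0`). [folklore] -/
theorem lo_lt_one_iff (hA : K.A < 0) {x y : ℝ} (hD : 0 < K.Dxy x y) :
    K.lo x y < 1 ↔ 2 * K.A + K.Bxy x y < 0 ∨ 0 < K.C1xy x y := by
  have hA' : (K.A : ℝ) < 0 := by exact_mod_cast hA
  have h2A : (2 : ℝ) * K.A < 0 := by linarith
  rw [lo_eq, div_lt_iff_of_neg h2A, one_mul]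
  exact lo_lt_one_aux hA' (Real.sqrt_pos.2 hD) (by rw [Real.sq_sqrt hD.le, Dxy])

/-- `hi > 0 ↔ B > 0 ∨ C₀ > 0` (for `A < 0`, `D > 0`). [folklore] -/
theorem hi_pos_iff (hA : K.A < 0) {x y : ℝ} (hD : 0 < K.Dxy x y) :
    0 < K.hi x y ↔ 0 < K.Bxy x y ∨ 0 < K.Cxy x y := by
  have hA' : (K.A : ℝ) < 0 := by exact_mod_cast hA
  have h2A : (2 : ℝ) * K.A < 0 := by linarith
  rw [hi_eq, lt_div_iff_of_neg h2A, zero_mul]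
  exact hi_pos_aux hA' (Real.sqrt_pos.2 hD) (by rw [Real.sq_sqrt hD.le, Dxy])

/-- `hi < 1 ↔ 2A + B < 0 ∧ C₁ < 0` (for `A < 0`, `D > 0`). [folklore] -/
theorem hi_lt_one_iff (hA : K.A < 0) {x y : ℝ} (hD : 0 < K.Dxy x y) :
    K.hi x y < 1 ↔ 2 * K.A + K.Bxy x y < 0 ∧ K.C1xy x y < 0 := by
  have hA' : (K.A : ℝ) < 0 := by exact_mod_cast hA
  have h2A : (2 : ℝ) * K.A < 0 := by linarith
  rw [hi_eq, div_lt_iff_of_neg h2A, one_mul]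
  exact hi_lt_one_aux hA' (Real.sqrt_pos.2 hD) (by rw [Real.sq_sqrt hD.le, Dxy])

/-- `B` is `ℚ`-semialgebraic on any `ℚ`-semialgebraic subset of the plane. [BCR1998 §2.2] -/
theorem isSemialgebraicFunOn_Bxy {X : Set (Fin 2 → ℝ)} (hX : IsSemialgebraic ℚ X) :
    IsSemialgebraicFunOn ℚ X fun v => K.Bxy (v 0) (v 1) :=
  (isSemialgebraicFunOn_aeval hX K.BxyP).congr fun v _ => K.aeval_BxyP v

/-- `D` is `ℚ`-semialgebraic on any `ℚ`-semialgebraic subset of the plane. [BCR1998 §2.2] -/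
theorem isSemialgebraicFunOn_Dxy {X : Set (Fin 2 → ℝ)} (hX : IsSemialgebraic ℚ X) :
    IsSemialgebraicFunOn ℚ X fun v => K.Dxy (v 0) (v 1) :=
  (isSemialgebraicFunOn_aeval hX (K.adaptedP 0)).congr fun v _ => K.aeval_adaptedP 0 v

/-- The root functions `(−B + ε√D)/(2A)` are `ℚ`-semialgebraic. [BCR1998 §2.2] -/
theorem isSemialgebraicFunOn_root (ε : ℚ) {X : Set (Fin 2 → ℝ)} (hX : IsSemialgebraic ℚ X) :
    IsSemialgebraicFunOn ℚ X fun v => K.root ε (v 0) (v 1) :=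
  (IsSemialgebraicFunOn.mul_holds (isSemialgebraicFunOn_ratCast hX (1 / (2 * K.A)))
    (IsSemialgebraicFunOn.add_holds (K.isSemialgebraicFunOn_Bxy hX).neg
      (IsSemialgebraicFunOn.mul_holds (isSemialgebraicFunOn_ratCast hX ε)
        (IsSemialgebraicFunOn.sqrt_holds (K.isSemialgebraicFunOn_Dxy hX))))).congr fun v _ => by
    simp only [root, Pi.mul_apply, Pi.add_apply, Pi.neg_apply]; push_cast; ring

/-- `lo` is `ℚ`-semialgebraic. [BCR1998 §2.2] -/
theorem isSemialgebraicFunOn_lo {X : Set (Fin 2 → ℝ)} (hX : IsSemialgebraic ℚ X) :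
    IsSemialgebraicFunOn ℚ X fun v => K.lo (v 0) (v 1) :=
  K.isSemialgebraicFunOn_root 1 hX

/-- `hi` is `ℚ`-semialgebraic. [BCR1998 §2.2] -/
theorem isSemialgebraicFunOn_hi {X : Set (Fin 2 → ℝ)} (hX : IsSemialgebraic ℚ X) :
    IsSemialgebraicFunOn ℚ X fun v => K.hi (v 0) (v 1) :=
  K.isSemialgebraicFunOn_root (-1) hX

/-- A sign-condition set of a polynomial is `ℚ`-semialgebraic. [BCR1998 §2.1] -/
theorem isSemialgebraic_signSet (p : MvPolynomial (Fin 2) ℚ) (s : SignType) :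
    IsSemialgebraic ℚ {v : Fin 2 → ℝ | SignType.sign (aeval v p) = s} := by
  rcases s with _ | _ | _
  · convert isSemialgebraic_setOf_eval_eq_zero (R := ℝ) p using 1
    ext v
    simp only [mem_setOf_eq, SignType.zero_eq_zero, sign_eq_zero_iff]
  · have : {v : Fin 2 → ℝ | SignType.sign (aeval v p) = SignType.neg} =
        {v : Fin 2 → ℝ | 0 < aeval v (-p)} := by
      ext v
      simp only [mem_setOf_eq, SignType.neg_eq_neg_one, sign_eq_neg_one_iff, map_neg, neg_pos]
    rw [this]
    exact isSemialgebraic_setOf_eval_pos _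
  · convert isSemialgebraic_setOf_eval_pos (R := ℝ) p using 1
    ext v
    simp only [mem_setOf_eq, SignType.pos_eq_one, sign_eq_one_iff]

/-- Adapted atoms are `ℚ`-semialgebraic. [BCR1998 §2.1] -/
theorem isSemialgebraic_atom (σ : Fin 5 → SignType) : IsSemialgebraic ℚ (K.atom σ) := by
  classical
  have h := IsSemialgebraic.biInter (k := ℚ) (R := ℝ) (Finset.univ : Finset (Fin 5))
    (fun i => {v : Fin 2 → ℝ | SignType.sign (aeval v (K.adaptedP i)) = σ i})
    fun i _ => isSemialgebraic_signSet _ _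
  convert isSemialgebraic_boxTwo.inter h using 1
  ext v
  simp only [atom, boxTwo, mem_inter_iff, mem_setOf_eq, mem_iInter, Finset.mem_univ, aeval_adaptedP,
    forall_true_left]

/-- Atoms lie in the open square. [this node] -/
theorem atom_subset_boxTwo (σ : Fin 5 → SignType) : K.atom σ ⊆ boxTwo := fun _ hv => hv.1

/-- Every point of the square lies in the atom of its own sign vector. [this node] -/
theorem mem_atom_sign {v : Fin 2 → ℝ} (hv : v ∈ boxTwo) :
    v ∈ K.atom fun i => SignType.sign (K.adapted i v) := ⟨hv, fun _ => rfl⟩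

/-- Atoms with different sign vectors are disjoint. [this node] -/
theorem atom_eq_of_mem {σ τ : Fin 5 → SignType} {v : Fin 2 → ℝ} (h₁ : v ∈ K.atom σ)
    (h₂ : v ∈ K.atom τ) : σ = τ :=
  funext fun i => (h₁.2 i).symm.trans (h₂.2 i)

/-- The five sign conditions on an atom, spelled out. [this node] -/
theorem atom_sign (σ : Fin 5 → SignType) {v : Fin 2 → ℝ} (hv : v ∈ K.atom σ) :
    SignType.sign (K.Dxy (v 0) (v 1)) = σ 0 ∧ SignType.sign (K.Cxy (v 0) (v 1)) = σ 1 ∧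
      SignType.sign (K.C1xy (v 0) (v 1)) = σ 2 ∧ SignType.sign (K.Bxy (v 0) (v 1)) = σ 3 ∧
        SignType.sign (2 * (K.A : ℝ) + K.Bxy (v 0) (v 1)) = σ 4 :=
  ⟨hv.2 0, hv.2 1, hv.2 2, hv.2 3, hv.2 4⟩

/-- On an atom with `σ 0 ≠ 1` the discriminant is `≤ 0`, so `√D = 0`. [this node] -/
theorem sqrt_Dxy_eq_zero_of_sign (σ : Fin 5 → SignType) (hσ : σ 0 ≠ 1) {v : Fin 2 → ℝ}
    (hv : v ∈ K.atom σ) : √(K.Dxy (v 0) (v 1)) = 0 :=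
  Real.sqrt_eq_zero'.2 (not_lt.1 fun h => hσ ((K.atom_sign σ hv).1.symm.trans (sign_eq_one_iff.2 h)))

/-- **Clamp regimes of `lo` are decided by the atom** (`A < 0`, `σ 0 = 1`): on `K.atom σ` the lower
root is everywhere `≤ 0`, or everywhere `≥ 1`, or everywhere in `(0, 1)`. [this node] -/
theorem clamp_lo_cases (hA : K.A < 0) (σ : Fin 5 → SignType) (hσ : σ 0 = 1) :
    (∀ v ∈ K.atom σ, K.lo (v 0) (v 1) ≤ 0) ∨ (∀ v ∈ K.atom σ, 1 ≤ K.lo (v 0) (v 1)) ∨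
      (∀ v ∈ K.atom σ, 0 < K.lo (v 0) (v 1) ∧ K.lo (v 0) (v 1) < 1) := by
  by_cases h1 : σ 3 = 1 ∧ σ 1 = -1
  · by_cases h2 : σ 4 = -1 ∨ σ 2 = 1
    · refine Or.inr (Or.inr fun v hv => ?_)
      obtain ⟨s0, s1, s2, s3, s4⟩ := K.atom_sign σ hv
      have hD : 0 < K.Dxy (v 0) (v 1) := sign_eq_one_iff.1 (s0.trans hσ)
      refine ⟨(K.lo_pos_iff hA hD).2 ⟨sign_eq_one_iff.1 (s3.trans h1.1),
        sign_eq_neg_one_iff.1 (s1.trans h1.2)⟩, (K.lo_lt_one_iff hA hD).2 ?_⟩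
      rcases h2 with h2 | h2
      · exact Or.inl (sign_eq_neg_one_iff.1 (s4.trans h2))
      · exact Or.inr (sign_eq_one_iff.1 (s2.trans h2))
    · refine Or.inr (Or.inl fun v hv => ?_)
      obtain ⟨s0, s1, s2, s3, s4⟩ := K.atom_sign σ hv
      have hD : 0 < K.Dxy (v 0) (v 1) := sign_eq_one_iff.1 (s0.trans hσ)
      by_contra hlt
      rcases (K.lo_lt_one_iff hA hD).1 (not_le.1 hlt) with h | h
      · exact h2 (Or.inl (s4.symm.trans (sign_eq_neg_one_iff.2 h)))
      · exact h2 (Or.inr (s2.symm.trans (sign_eq_one_iff.2 h)))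
  · refine Or.inl fun v hv => ?_
    obtain ⟨s0, s1, s2, s3, s4⟩ := K.atom_sign σ hv
    have hD : 0 < K.Dxy (v 0) (v 1) := sign_eq_one_iff.1 (s0.trans hσ)
    by_contra hlt
    obtain ⟨hB, hC⟩ := (K.lo_pos_iff hA hD).1 (not_le.1 hlt)
    exact h1 ⟨s3.symm.trans (sign_eq_one_iff.2 hB), s1.symm.trans (sign_eq_neg_one_iff.2 hC)⟩

/-- **Clamp regimes of `hi` are decided by the atom** (`A < 0`, `σ 0 = 1`). [this node] -/
theorem clamp_hi_cases (hA : K.A < 0) (σ : Fin 5 → SignType) (hσ : σ 0 = 1) :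
    (∀ v ∈ K.atom σ, K.hi (v 0) (v 1) ≤ 0) ∨ (∀ v ∈ K.atom σ, 1 ≤ K.hi (v 0) (v 1)) ∨
      (∀ v ∈ K.atom σ, 0 < K.hi (v 0) (v 1) ∧ K.hi (v 0) (v 1) < 1) := by
  by_cases h1 : σ 3 = 1 ∨ σ 1 = 1
  · by_cases h2 : σ 4 = -1 ∧ σ 2 = -1
    · refine Or.inr (Or.inr fun v hv => ?_)
      obtain ⟨s0, s1, s2, s3, s4⟩ := K.atom_sign σ hv
      have hD : 0 < K.Dxy (v 0) (v 1) := sign_eq_one_iff.1 (s0.trans hσ)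
      refine ⟨(K.hi_pos_iff hA hD).2 ?_, (K.hi_lt_one_iff hA hD).2
        ⟨sign_eq_neg_one_iff.1 (s4.trans h2.1), sign_eq_neg_one_iff.1 (s2.trans h2.2)⟩⟩
      rcases h1 with h1 | h1
      · exact Or.inl (sign_eq_one_iff.1 (s3.trans h1))
      · exact Or.inr (sign_eq_one_iff.1 (s1.trans h1))
    · refine Or.inr (Or.inl fun v hv => ?_)
      obtain ⟨s0, s1, s2, s3, s4⟩ := K.atom_sign σ hv
      have hD : 0 < K.Dxy (v 0) (v 1) := sign_eq_one_iff.1 (s0.trans hσ)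
      by_contra hlt
      obtain ⟨he, hC⟩ := (K.hi_lt_one_iff hA hD).1 (not_le.1 hlt)
      exact h2 ⟨s4.symm.trans (sign_eq_neg_one_iff.2 he), s2.symm.trans (sign_eq_neg_one_iff.2 hC)⟩
  · refine Or.inl fun v hv => ?_
    obtain ⟨s0, s1, s2, s3, s4⟩ := K.atom_sign σ hv
    have hD : 0 < K.Dxy (v 0) (v 1) := sign_eq_one_iff.1 (s0.trans hσ)
    by_contra hlt
    rcases (K.hi_pos_iff hA hD).1 (not_le.1 hlt) with h | h
    · exact h1 (Or.inl (s3.symm.trans (sign_eq_one_iff.2 h)))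
    · exact h1 (Or.inr (s1.symm.trans (sign_eq_one_iff.2 h)))

/-! The sign-flipped quadric `−p` (used for `A > 0`). -/

/-- The negated quadric `−p`. -/
def neg : Quadric₃ :=
  ⟨-K.A, -K.b0, -K.b1, -K.b2, -K.c0, -K.c1, -K.c2, -K.c11, -K.c12, -K.c22⟩

/-- `(−p).A = −A`. [this node] -/
@[simp] theorem neg_A : K.neg.A = -K.A := rfl

/-- `B₋ = −B`. [this node] -/
theorem neg_Bxy (x y : ℝ) : K.neg.Bxy x y = -K.Bxy x y := by
  simp only [Bxy, neg]; push_cast; ring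

/-- `C₋ = −C`. [this node] -/
theorem neg_Cxy (x y : ℝ) : K.neg.Cxy x y = -K.Cxy x y := by
  simp only [Cxy, neg]; push_cast; ring

/-- `C₁₋ = −C₁`. [this node] -/
theorem neg_C1xy (x y : ℝ) : K.neg.C1xy x y = -K.C1xy x y := by
  simp only [C1xy, neg_Bxy, neg_Cxy, neg_A]; push_cast; ring

/-- `D₋ = D`. [this node] -/
theorem neg_Dxy (x y : ℝ) : K.neg.Dxy x y = K.Dxy x y := by
  simp only [Dxy, neg_Bxy, neg_Cxy, neg_A]; push_cast; ring

/-- `p₋ = −p`. [this node] -/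
theorem neg_pxyz (x y z : ℝ) : K.neg.pxyz x y z = -K.pxyz x y z := by
  simp only [pxyz, neg_Bxy, neg_Cxy, neg_A]; push_cast; ring

/-- The sign vector of an atom of `−p` in terms of the atoms of `p`: `D` is unchanged, the other
four adapted functions change sign. -/
def negSign (σ : Fin 5 → SignType) : Fin 5 → SignType
  | ⟨0, _⟩ => σ 0
  | ⟨i + 1, h⟩ => -σ ⟨i + 1, h⟩

/-- The atoms of `−p` are atoms of `p` (with permuted sign vectors). [this node] -/
theorem mem_neg_atom_iff (σ : Fin 5 → SignType) (v : Fin 2 → ℝ) :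
    v ∈ K.neg.atom σ ↔ v ∈ K.atom (negSign σ) := by
  simp only [atom, mem_setOf_eq]
  refine and_congr Iff.rfl (forall_congr' fun i => ?_)
  fin_cases i
  · show SignType.sign (K.neg.Dxy (v 0) (v 1)) = σ 0 ↔ SignType.sign (K.Dxy (v 0) (v 1)) = σ 0
    rw [neg_Dxy]
  · show SignType.sign (K.neg.Cxy (v 0) (v 1)) = σ 1 ↔ SignType.sign (K.Cxy (v 0) (v 1)) = -σ 1
    rw [neg_Cxy, Left.sign_neg, neg_eq_iff_eq_neg]
  · show SignType.sign (K.neg.C1xy (v 0) (v 1)) = σ 2 ↔ SignType.sign (K.C1xy (v 0) (v 1)) = -σ 2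
    rw [neg_C1xy, Left.sign_neg, neg_eq_iff_eq_neg]
  · show SignType.sign (K.neg.Bxy (v 0) (v 1)) = σ 3 ↔ SignType.sign (K.Bxy (v 0) (v 1)) = -σ 3
    rw [neg_Bxy, Left.sign_neg, neg_eq_iff_eq_neg]
  · show SignType.sign (2 * ((K.neg.A : ℚ) : ℝ) + K.neg.Bxy (v 0) (v 1)) = σ 4 ↔
      SignType.sign (2 * (K.A : ℝ) + K.Bxy (v 0) (v 1)) = -σ 4
    rw [show 2 * ((K.neg.A : ℚ) : ℝ) + K.neg.Bxy (v 0) (v 1) = -(2 * (K.A : ℝ) + K.Bxy (v 0) (v 1)) by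
      rw [neg_A, neg_Bxy]; push_cast; ring, Left.sign_neg, neg_eq_iff_eq_neg]

/-- `PxyzP` is not the zero function when `A ≠ 0` (second difference along the fibre over `(0,0)`).
[folklore] -/
theorem exists_aeval_PxyzP_ne_zero (hA : K.A ≠ 0) : ∃ v : Fin 3 → ℝ, aeval v K.PxyzP ≠ 0 := by
  by_contra h
  push Not at h
  have h0 := h ![0, 0, 0]
  have h1 := h ![0, 0, 1]
  have h2 := h ![0, 0, 2]
  simp only [aeval_PxyzP, pxyz, Bxy, Cxy, Matrix.cons_val_zero, Matrix.cons_val_one,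
    Matrix.cons_val_two, Matrix.head_cons, Matrix.tail_cons] at h0 h1 h2
  have hA' : (K.A : ℝ) ≠ 0 := by exact_mod_cast hA
  apply hA'
  nlinarith [h0, h1, h2]

end Quadric₃

end Summit.KontsevichZagierPeriods.RootDecompWalshStrata.ConicDescent.BallCube
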